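import Summits.AtomisticToContinuum.HydrodynamicLimit.Theses.AntiMazurCoboundaries
import Literature.MathematicalPhysics.KineticTheory.HardSphereEulerProofs
import Literature.Probability.Divergences.FDivVariational

/-!
# The bias split in Hellinger variables (stub 3)

Helper file (`--supports stmt-AtomisticToContinuum-14135`) proving the registered stub `stub_hellingerBiasSplit` of the lead's skeleton
`Cruxes/CorrectorPressureDecay/Lines/kinetic-entropy-collision-budget.lean` (line `kinetic-entropy-collision-budget`) of
the crux `Summit.AtomisticToContinuum.HydrodynamicLimit.Theses.AntiMazurCoboundaries.CorrectorPressureDecay`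
(stmt-AtomisticToContinuum-14135, route `AntiMazurCoboundaries`). The statement is spelled over tree primitives exactly
as registered; see the skeleton for the objects it abbreviates (`discAvg`, `optimiser`, `windowOneBodyLaw`, `condKL`,
`fastDev`).

Proof summary. Write `R = πˣ ⊗ γ`, `r = dπ/dR` and `u = √r - 1`. Everything rests on the POINTWISE
inequality `(√y - 1)² ≤ klFun y = y log y + 1 - y` (`sq_sqrt_sub_one_le_klFun`, i.e. `log(1/√y) ≤ 1/√y - 1`),
so no marginal identity and no chain rule are needed: (i) the fast deviation is bounded by taking the weight
`q = 0` in the infimum, `∫⁻ ⨅_q ‖u - q‖² ≤ ∫⁻∫⁻ u² ≤ ∫⁻ klFun r dR = KL(π‖R)` (Tonelli,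
`klDiv_eq_lintegral_klFun_of_ac`); (ii) `∫ φ g dπ = ∫ r φ g dR = ∫ φ(x) (∫ g r(x,·) dγ) dπˣ`
(`integral_toReal_rnDeriv_mul`, `integral_prod`), and fibrewise, for `πˣ`-a.e. `x` (where `klFun r(x,·) ∈ L¹(γ)`,
hence `u(x,·) ∈ L²(γ)`): `∫ g r dγ = 2∫ g u dγ + ∫ g u² dγ` (`∫ g dγ = 0`, `r = 1 + 2u + u²`) with
`|∫ g u² dγ| ≤ κ ∫ klFun r(x,·) dγ` (`abs_integral_mul_density_le`) and, for EVERY weight `q` with `g ⊥ q`,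
`(∫ g u dγ / κ)² ≤ ∫⁻ (u - q)² dγ` in `ℝ≥0∞` (`ofReal_sq_integral_mul_div_le`: `∫ g u = ∫ g (u - q)`, `|g| ≤ κ`,
Jensen `(∫|w|)² ≤ ∫ w²`; trivial when `u - q ∉ L²`), hence `≤` the infimum (`le_iInf`). Integrating the measurable
minorant `x ↦ (G(x)/κ)²`, `G(x) = ∫ g u(x,·) dγ`, against `πˣ` by `lintegral_mono_ae` bounds `∫ (G/κ)² dπˣ` by the
fast deviation WITHOUT any measurability of the infimum itself, and Jensen once more gives
`∫ |G| dπˣ ≤ κ √(fd)`; finally `∫ₓ∫ klFun r dγ dπˣ = KL(π‖R)` (`toReal_klDiv_eq_integral_klFun`). The general form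
(any product reference `μˣ ⊗ γ`, any family of weights containing `0`) is `integral_mul_le_of_orthogonal_of_klDiv`;
the registered stub specialises it to `γ = stdGaussian V3` and the quadratic weights `c₀ + ⟪b,v⟫ + c₂‖v‖²`.
-/

noncomputable section

open MeasureTheory ProbabilityTheory InformationTheory Set Filter Topology
open scoped ENNReal

namespace Summit.AtomisticToContinuum.HydrodynamicLimit.Theorems.KineticEntropyCollisionBudget

open Literature.MathematicalPhysics.KineticTheory (T3 V3 hsDiameter localGibbsLaw)
open Literature.Analysis.FluidPDE (HardSphereFlow Config)

/-- Pointwise Hellinger-vs-entropy inequality: `(√y - 1)² ≤ y log y + 1 - y` for `y ≥ 0`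
(`log(1/√y) ≤ 1/√y - 1`). -/
theorem sq_sqrt_sub_one_le_klFun {y : ℝ} (hy : 0 ≤ y) :
    (Real.sqrt y - 1) ^ 2 ≤ klFun y := by
  rcases hy.eq_or_lt with rfl | hy
  · simp [klFun_zero]
  set s := Real.sqrt y with hs
  have hs0 : 0 < s := Real.sqrt_pos.2 hy
  have hys : y = s ^ 2 := (Real.sq_sqrt hy.le).symm
  have hlog : Real.log y = 2 * Real.log s := by
    rw [hys, Real.log_pow]; norm_num
  have h1 : 1 - s⁻¹ ≤ Real.log s := Real.one_sub_inv_le_log_of_pos hs0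
  rw [klFun_apply, hlog, hys]
  have h2 : s - 1 ≤ s * Real.log s := by
    have := mul_le_mul_of_nonneg_left h1 hs0.le
    rwa [mul_sub, mul_one, mul_inv_cancel₀ hs0.ne'] at this
  nlinarith [h2, hs0]

/-- Jensen on a probability space: `(∫ |f|)² ≤ ∫ f²` for `f ∈ L²`. -/
theorem sq_integral_abs_le_integral_sq {Ω : Type*} [MeasurableSpace Ω] {μ : Measure Ω}
    [IsProbabilityMeasure μ] {f : Ω → ℝ} (hf : MemLp f 2 μ) :
    (∫ x, |f x| ∂μ) ^ 2 ≤ ∫ x, f x ^ 2 ∂μ := by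
  have h := variance_eq_sub hf.norm
  have h0 := variance_nonneg (fun x => ‖f x‖) μ
  rw [h] at h0
  simp only [Real.norm_eq_abs, Pi.pow_apply, sq_abs] at h0
  linarith

/-- Fibrewise first-order bound: if `|g| ≤ κ`, `u ∈ L²(γ)` and `g ⊥ q`, then
`(∫ g u dγ / κ)² ≤ ∫ (u - q)² dγ` (in `ℝ≥0∞`, so that `q ∉ L²` is harmless): `∫ g u = ∫ g (u - q)`,
then `|g| ≤ κ` and Jensen. -/
theorem ofReal_sq_integral_mul_div_le {V : Type*} [MeasurableSpace V] {γ : Measure V}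
    [IsProbabilityMeasure γ] {g u q : V → ℝ} {κ : ℝ} (hκ : 0 < κ)
    (hg : AEStronglyMeasurable g γ) (hgκ : ∀ v, |g v| ≤ κ) (hu : MemLp u 2 γ)
    (hq : AEStronglyMeasurable q γ) (horth : ∫ v, g v * q v ∂γ = 0) :
    ENNReal.ofReal (((∫ v, g v * u v ∂γ) / κ) ^ 2) ≤
      ∫⁻ v, ENNReal.ofReal ((u v - q v) ^ 2) ∂γ := by
  by_cases hfin : ∫⁻ v, ENNReal.ofReal ((u v - q v) ^ 2) ∂γ = ∞
  · rw [hfin]; exact le_top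
  have hw_meas : AEStronglyMeasurable (fun v => u v - q v) γ := hu.1.sub hq
  have hw_int2 : Integrable (fun v => (u v - q v) ^ 2) γ :=
    (lintegral_ofReal_ne_top_iff_integrable (hw_meas.pow 2)
      (ae_of_all _ fun v => sq_nonneg _)).1 hfin
  have hw : MemLp (fun v => u v - q v) 2 γ := (memLp_two_iff_integrable_sq hw_meas).2 hw_int2
  have hw1 : Integrable (fun v => u v - q v) γ := hw.integrable one_le_two
  have hu1 : Integrable u γ := hu.integrable one_le_two
  have hq1 : Integrable q γ := by
    refine (hu1.sub hw1).congr (ae_of_all _ fun v => ?_)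
    simp
  have hgb : ∀ᵐ v ∂γ, ‖g v‖ ≤ κ := ae_of_all _ fun v => by simpa [Real.norm_eq_abs] using hgκ v
  have hgw : Integrable (fun v => g v * (u v - q v)) γ := hw1.bdd_mul hg hgb
  have hgq : Integrable (fun v => g v * q v) γ := hq1.bdd_mul hg hgb
  have hsplit : ∫ v, g v * u v ∂γ = ∫ v, g v * (u v - q v) ∂γ := by
    have : (fun v => g v * u v) = fun v => g v * (u v - q v) + g v * q v := by
      ext v; ring
    rw [this, integral_add hgw hgq, horth, add_zero]
  have hb : |∫ v, g v * (u v - q v) ∂γ| ≤ κ * ∫ v, |u v - q v| ∂γ := by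
    calc |∫ v, g v * (u v - q v) ∂γ| ≤ ∫ v, |g v * (u v - q v)| ∂γ :=
          abs_integral_le_integral_abs
      _ ≤ ∫ v, κ * |u v - q v| ∂γ := by
          refine integral_mono hgw.abs (hw1.abs.const_mul κ) fun v => ?_
          simp only [abs_mul]
          exact mul_le_mul_of_nonneg_right (hgκ v) (abs_nonneg _)
      _ = κ * ∫ v, |u v - q v| ∂γ := integral_const_mul _ _
  have hj : (∫ v, |u v - q v| ∂γ) ^ 2 ≤ ∫ v, (u v - q v) ^ 2 ∂γ :=
    sq_integral_abs_le_integral_sq hw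
  rw [← ofReal_integral_eq_lintegral_ofReal hw_int2 (ae_of_all _ fun v => sq_nonneg _)]
  refine ENNReal.ofReal_le_ofReal ?_
  rw [div_pow, div_le_iff₀ (pow_pos hκ 2), hsplit]
  calc (∫ v, g v * (u v - q v) ∂γ) ^ 2 = |∫ v, g v * (u v - q v) ∂γ| ^ 2 := (sq_abs _).symm
    _ ≤ (κ * ∫ v, |u v - q v| ∂γ) ^ 2 := pow_le_pow_left₀ (abs_nonneg _) hb 2
    _ = (∫ v, |u v - q v| ∂γ) ^ 2 * κ ^ 2 := by ring
    _ ≤ (∫ v, (u v - q v) ^ 2 ∂γ) * κ ^ 2 := mul_le_mul_of_nonneg_right hj (sq_nonneg _)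

/-- Fibrewise decomposition and second-order bound: for a density-like `ρ ≥ 0` with
`∫ klFun ρ dγ < ∞`, `|g| ≤ κ` and `∫ g dγ = 0`, the Hellinger variable `u = √ρ - 1` is in `L²(γ)`
and `|∫ g ρ dγ| ≤ 2 |∫ g u dγ| + κ ∫ klFun ρ dγ` (`ρ = 1 + 2u + u²`, `u² ≤ klFun ρ`). -/
theorem abs_integral_mul_density_le {V : Type*} [MeasurableSpace V] {γ : Measure V}
    [IsProbabilityMeasure γ] {g ρ : V → ℝ} {κ : ℝ}
    (hg : AEStronglyMeasurable g γ) (hgκ : ∀ v, |g v| ≤ κ) (hg0 : ∫ v, g v ∂γ = 0)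
    (hρm : AEStronglyMeasurable ρ γ) (hρ0 : ∀ v, 0 ≤ ρ v)
    (hkl : Integrable (fun v => klFun (ρ v)) γ) :
    MemLp (fun v => Real.sqrt (ρ v) - 1) 2 γ ∧
      |∫ v, g v * ρ v ∂γ| ≤
        2 * |∫ v, g v * (Real.sqrt (ρ v) - 1) ∂γ| + κ * ∫ v, klFun (ρ v) ∂γ := by
  have hu_meas : AEStronglyMeasurable (fun v => Real.sqrt (ρ v) - 1) γ :=
    (Real.continuous_sqrt.comp_aestronglyMeasurable hρm).sub aestronglyMeasurable_const
  have hu2_le : ∀ v, (Real.sqrt (ρ v) - 1) ^ 2 ≤ klFun (ρ v) := fun v =>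
    sq_sqrt_sub_one_le_klFun (hρ0 v)
  have hu2 : Integrable (fun v => (Real.sqrt (ρ v) - 1) ^ 2) γ :=
    hkl.mono' (hu_meas.pow 2) (ae_of_all _ fun v => by
      rw [Real.norm_eq_abs, abs_of_nonneg (sq_nonneg _)]; exact hu2_le v)
  have hu : MemLp (fun v => Real.sqrt (ρ v) - 1) 2 γ := (memLp_two_iff_integrable_sq hu_meas).2 hu2
  refine ⟨hu, ?_⟩
  have hu1 : Integrable (fun v => Real.sqrt (ρ v) - 1) γ := hu.integrable one_le_two
  have hgb : ∀ᵐ v ∂γ, ‖g v‖ ≤ κ := ae_of_all _ fun v => by simpa [Real.norm_eq_abs] using hgκ v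
  have hg1 : Integrable g γ := (integrable_const κ).mono' hg hgb
  have hgu : Integrable (fun v => g v * (Real.sqrt (ρ v) - 1)) γ := hu1.bdd_mul hg hgb
  have hgu2 : Integrable (fun v => g v * (Real.sqrt (ρ v) - 1) ^ 2) γ := hu2.bdd_mul hg hgb
  have hexp : (fun v => g v * ρ v) =
      fun v => g v + 2 * (g v * (Real.sqrt (ρ v) - 1)) + g v * (Real.sqrt (ρ v) - 1) ^ 2 := by
    ext v
    have := Real.sq_sqrt (hρ0 v)
    linear_combination (-(g v)) * this
  have hsplit : ∫ v, g v * ρ v ∂γ =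
      2 * ∫ v, g v * (Real.sqrt (ρ v) - 1) ∂γ + ∫ v, g v * (Real.sqrt (ρ v) - 1) ^ 2 ∂γ := by
    have h12 : Integrable (fun v => g v + 2 * (g v * (Real.sqrt (ρ v) - 1))) γ :=
      hg1.add (hgu.const_mul 2)
    rw [hexp, integral_add h12 hgu2, integral_add hg1 (hgu.const_mul 2), integral_const_mul, hg0,
      zero_add]
  have h2nd : |∫ v, g v * (Real.sqrt (ρ v) - 1) ^ 2 ∂γ| ≤ κ * ∫ v, klFun (ρ v) ∂γ := by
    calc |∫ v, g v * (Real.sqrt (ρ v) - 1) ^ 2 ∂γ|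
        ≤ ∫ v, |g v * (Real.sqrt (ρ v) - 1) ^ 2| ∂γ := abs_integral_le_integral_abs
      _ ≤ ∫ v, κ * klFun (ρ v) ∂γ := by
          refine integral_mono hgu2.abs (hkl.const_mul κ) fun v => ?_
          rw [abs_mul, abs_of_nonneg (sq_nonneg (Real.sqrt (ρ v) - 1))]
          exact mul_le_mul (hgκ v) (hu2_le v) (sq_nonneg _) ((abs_nonneg _).trans (hgκ v))
      _ = κ * ∫ v, klFun (ρ v) ∂γ := integral_const_mul _ _
  rw [hsplit]
  calc |2 * ∫ v, g v * (Real.sqrt (ρ v) - 1) ∂γ + ∫ v, g v * (Real.sqrt (ρ v) - 1) ^ 2 ∂γ|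
      ≤ |2 * ∫ v, g v * (Real.sqrt (ρ v) - 1) ∂γ| + |∫ v, g v * (Real.sqrt (ρ v) - 1) ^ 2 ∂γ| :=
        abs_add_le _ _
    _ ≤ 2 * |∫ v, g v * (Real.sqrt (ρ v) - 1) ∂γ| + κ * ∫ v, klFun (ρ v) ∂γ := by
        rw [abs_mul, abs_two]; exact add_le_add le_rfl h2nd

/-- The bias split in Hellinger variables, general form: for a probability law `μ` on `X × V` with
`KL(μ ‖ μˣ ⊗ γ) < ∞` and density `r = dμ/d(μˣ ⊗ γ)`, measurable `|φ| ≤ 1`, `|g| ≤ κ`, `∫ g dγ = 0`,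
and a family of measurable weights `Q i` containing `0` with `g ⊥ Q i` for all `i`: the fast
deviation `∫ ⨅ᵢ ‖√r(x,·) - 1 - Q i‖²_{L²(γ)} dμˣ` is at most `KL(μ ‖ μˣ ⊗ γ)`, and
`∫ φ(x) g(v) dμ ≤ 2κ √(fast deviation) + κ KL(μ ‖ μˣ ⊗ γ)`. -/
theorem integral_mul_le_of_orthogonal_of_klDiv {X V ι : Type*} [MeasurableSpace X]
    [MeasurableSpace V] (μ : Measure (X × V)) [IsProbabilityMeasure μ] (γ : Measure V)
    [IsProbabilityMeasure γ] (hKL : klDiv μ (μ.fst.prod γ) ≠ ∞)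
    (r : X × V → ℝ≥0∞) (hr : r = μ.rnDeriv (μ.fst.prod γ))
    (φ : X → ℝ) (g : V → ℝ) (κ : ℝ) (hφm : Measurable φ) (hgm : Measurable g)
    (hφ1 : ∀ x, |φ x| ≤ 1) (hgκ : ∀ v, |g v| ≤ κ) (hg0 : ∫ v, g v ∂γ = 0)
    (Q : ι → V → ℝ) (hQm : ∀ i, Measurable (Q i)) (hQ0 : ∃ i₀, ∀ v, Q i₀ v = 0)
    (horth : ∀ i, ∫ v, g v * Q i v ∂γ = 0) :
    (∫⁻ x, ⨅ i, ∫⁻ v, ENNReal.ofReal ((Real.sqrt ((r (x, v)).toReal) - 1 - Q i v) ^ 2) ∂γ ∂μ.fst)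
        ≤ klDiv μ (μ.fst.prod γ) ∧
      ∫ p, φ p.1 * g p.2 ∂μ ≤
        2 * κ * Real.sqrt (∫⁻ x, ⨅ i, ∫⁻ v,
            ENNReal.ofReal ((Real.sqrt ((r (x, v)).toReal) - 1 - Q i v) ^ 2) ∂γ ∂μ.fst).toReal +
          κ * (klDiv μ (μ.fst.prod γ)).toReal := by
  obtain ⟨hac, hllr⟩ := klDiv_ne_top_iff.1 hKL
  have hr_meas : Measurable r := hr ▸ Measure.measurable_rnDeriv μ _
  have hkl_int : Integrable (fun p => klFun (r p).toReal) (μ.fst.prod γ) := by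
    rw [hr]; exact (integrable_klFun_rnDeriv_iff hac).2 hllr
  have hKL_real : (klDiv μ (μ.fst.prod γ)).toReal = ∫ p, klFun (r p).toReal ∂(μ.fst.prod γ) := by
    rw [hr]; exact toReal_klDiv_eq_integral_klFun hac
  have hKL_lint : klDiv μ (μ.fst.prod γ) =
      ∫⁻ p, ENNReal.ofReal (klFun (r p).toReal) ∂(μ.fst.prod γ) := by
    rw [hr]; exact klDiv_eq_lintegral_klFun_of_ac hac
  have hmeas_kl : Measurable fun p : X × V => ENNReal.ofReal (klFun (r p).toReal) :=
    (measurable_klFun.comp hr_meas.ennreal_toReal).ennreal_ofReal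
  -- Part (i): the fast deviation is at most the conditional entropy.
  have hD_le : (∫⁻ x, ⨅ i, ∫⁻ v,
      ENNReal.ofReal ((Real.sqrt ((r (x, v)).toReal) - 1 - Q i v) ^ 2) ∂γ ∂μ.fst)
        ≤ klDiv μ (μ.fst.prod γ) := by
    rw [hKL_lint, lintegral_prod _ hmeas_kl.aemeasurable]
    obtain ⟨i₀, hi₀⟩ := hQ0
    refine lintegral_mono fun x => iInf_le_of_le i₀ (lintegral_mono fun v => ?_)
    rw [hi₀, sub_zero]
    exact ENNReal.ofReal_le_ofReal (sq_sqrt_sub_one_le_klFun ENNReal.toReal_nonneg)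
  have hD_ne : (∫⁻ x, ⨅ i, ∫⁻ v,
      ENNReal.ofReal ((Real.sqrt ((r (x, v)).toReal) - 1 - Q i v) ^ 2) ∂γ ∂μ.fst) ≠ ∞ :=
    ne_top_of_le_ne_top hKL hD_le
  refine ⟨hD_le, ?_⟩
  -- Degenerate amplitude.
  obtain ⟨v₀⟩ := γ.nonempty_of_neZero
  have hκ0 : 0 ≤ κ := (abs_nonneg _).trans (hgκ v₀)
  rcases hκ0.eq_or_lt with hκ | hκ
  · subst hκ
    have hg00 : ∀ v, g v = 0 := fun v => abs_nonpos_iff.1 (hgκ v)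
    simp [hg00]
  -- Fibrewise integrability of `klFun r(x,·)` for a.e. `x`.
  have hkl_ae : ∀ᵐ x ∂μ.fst, Integrable (fun v => klFun (r (x, v)).toReal) γ :=
    hkl_int.prod_right_ae
  have hρm : ∀ x, AEStronglyMeasurable (fun v => (r (x, v)).toReal) γ := fun x =>
    (hr_meas.ennreal_toReal.comp measurable_prodMk_left).aestronglyMeasurable
  -- The first-order term `G(x) = ∫ g u(x,·) dγ`.
  have hf_meas : Measurable fun p : X × V => g p.2 * (Real.sqrt ((r p).toReal) - 1) :=
    (hgm.comp measurable_snd).mul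
      ((Real.continuous_sqrt.measurable.comp hr_meas.ennreal_toReal).sub measurable_const)
  obtain ⟨G, hGx⟩ : ∃ G : X → ℝ, ∀ x, ∫ v, g v * (Real.sqrt ((r (x, v)).toReal) - 1) ∂γ = G x :=
    ⟨_, fun x => rfl⟩
  have hG_meas : StronglyMeasurable G := by
    rw [← funext hGx]; exact hf_meas.stronglyMeasurable.integral_prod_right'
  have hG_le : ∀ᵐ x ∂μ.fst, ENNReal.ofReal ((G x / κ) ^ 2) ≤
      ⨅ i, ∫⁻ v, ENNReal.ofReal ((Real.sqrt ((r (x, v)).toReal) - 1 - Q i v) ^ 2) ∂γ := by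
    filter_upwards [hkl_ae] with x hx
    have hfib := abs_integral_mul_density_le hgm.aestronglyMeasurable hgκ hg0 (hρm x)
      (fun v => ENNReal.toReal_nonneg) hx
    rw [← hGx x]
    exact le_iInf fun i => ofReal_sq_integral_mul_div_le hκ hgm.aestronglyMeasurable hgκ hfib.1
      (hQm i).aestronglyMeasurable (horth i)
  have hG2_le : ∫⁻ x, ENNReal.ofReal ((G x / κ) ^ 2) ∂μ.fst ≤
      ∫⁻ x, ⨅ i, ∫⁻ v,
        ENNReal.ofReal ((Real.sqrt ((r (x, v)).toReal) - 1 - Q i v) ^ 2) ∂γ ∂μ.fst :=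
    lintegral_mono_ae hG_le
  generalize (∫⁻ x, ⨅ i, ∫⁻ v,
      ENNReal.ofReal ((Real.sqrt ((r (x, v)).toReal) - 1 - Q i v) ^ 2) ∂γ ∂μ.fst) = D
    at hD_ne hG2_le ⊢
  have hGκ_meas : AEStronglyMeasurable (fun x => (G x / κ) ^ 2) μ.fst :=
    ((hG_meas.measurable.div_const κ).pow_const 2).aestronglyMeasurable
  have hGκ_int2 : Integrable (fun x => (G x / κ) ^ 2) μ.fst :=
    (lintegral_ofReal_ne_top_iff_integrable hGκ_meas (ae_of_all _ fun _ => sq_nonneg _)).1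
      (ne_top_of_le_ne_top hD_ne hG2_le)
  have hGκ_mem : MemLp (fun x => G x / κ) 2 μ.fst :=
    (memLp_two_iff_integrable_sq (hG_meas.measurable.div_const κ).aestronglyMeasurable).2 hGκ_int2
  have hG_int : Integrable G μ.fst := by
    refine ((hGκ_mem.integrable one_le_two).const_mul κ).congr (ae_of_all _ fun x => ?_)
    simp only [mul_div_cancel₀ _ hκ.ne']
  have hint_abs : ∫ x, |G x / κ| ∂μ.fst ≤ Real.sqrt D.toReal := by
    refine Real.le_sqrt_of_sq_le ?_
    calc (∫ x, |G x / κ| ∂μ.fst) ^ 2 ≤ ∫ x, (G x / κ) ^ 2 ∂μ.fst :=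
          sq_integral_abs_le_integral_sq hGκ_mem
      _ = (∫⁻ x, ENNReal.ofReal ((G x / κ) ^ 2) ∂μ.fst).toReal :=
          integral_eq_lintegral_of_nonneg_ae (ae_of_all _ fun _ => sq_nonneg _) hGκ_meas
      _ ≤ D.toReal := ENNReal.toReal_mono hD_ne hG2_le
  have hint_G : ∫ x, |G x| ∂μ.fst ≤ κ * Real.sqrt D.toReal := by
    have : ∫ x, |G x| ∂μ.fst = κ * ∫ x, |G x / κ| ∂μ.fst := by
      rw [← integral_const_mul]
      refine integral_congr_ae (ae_of_all _ fun x => ?_)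
      simp only [abs_div, abs_of_pos hκ, mul_div_cancel₀ _ hκ.ne']
    rw [this]
    exact mul_le_mul_of_nonneg_left hint_abs hκ.le
  -- Change of measure and Fubini.
  have hφg_meas : Measurable fun p : X × V => φ p.1 * g p.2 :=
    (hφm.comp measurable_fst).mul (hgm.comp measurable_snd)
  have hφg_int : Integrable (fun p : X × V => φ p.1 * g p.2) μ := by
    refine (integrable_const κ).mono' hφg_meas.aestronglyMeasurable (ae_of_all _ fun p => ?_)
    rw [Real.norm_eq_abs, abs_mul]
    calc |φ p.1| * |g p.2| ≤ 1 * κ := mul_le_mul (hφ1 _) (hgκ _) (abs_nonneg _) zero_le_one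
      _ = κ := one_mul κ
  have hF_int : Integrable (fun p => (r p).toReal * (φ p.1 * g p.2)) (μ.fst.prod γ) := by
    rw [hr]; exact (integrable_toReal_rnDeriv_mul_iff hac).2 hφg_int
  have hchange : ∫ p, φ p.1 * g p.2 ∂μ = ∫ p, (r p).toReal * (φ p.1 * g p.2) ∂(μ.fst.prod γ) := by
    rw [hr]; exact (integral_toReal_rnDeriv_mul hac).symm
  rw [hchange, integral_prod _ hF_int]
  have hK_eq : ∫ x, ∫ v, klFun (r (x, v)).toReal ∂γ ∂μ.fst = (klDiv μ (μ.fst.prod γ)).toReal := by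
    rw [hKL_real, integral_prod _ hkl_int]
  have hinner : ∀ᵐ x ∂μ.fst, ∫ v, (r (x, v)).toReal * (φ x * g v) ∂γ ≤
      2 * |G x| + κ * ∫ v, klFun (r (x, v)).toReal ∂γ := by
    filter_upwards [hkl_ae] with x hx
    have hfib := (abs_integral_mul_density_le hgm.aestronglyMeasurable hgκ hg0 (hρm x)
      (fun v => ENNReal.toReal_nonneg) hx).2
    rw [hGx x] at hfib
    have : ∫ v, (r (x, v)).toReal * (φ x * g v) ∂γ = φ x * ∫ v, g v * (r (x, v)).toReal ∂γ := by
      rw [← integral_const_mul]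
      refine integral_congr_ae (ae_of_all _ fun v => ?_)
      simp only; ring
    rw [this]
    calc φ x * ∫ v, g v * (r (x, v)).toReal ∂γ ≤ |φ x * ∫ v, g v * (r (x, v)).toReal ∂γ| :=
          le_abs_self _
      _ = |φ x| * |∫ v, g v * (r (x, v)).toReal ∂γ| := abs_mul _ _
      _ ≤ 1 * (2 * |G x| + κ * ∫ v, klFun (r (x, v)).toReal ∂γ) :=
          mul_le_mul (hφ1 x) hfib (abs_nonneg _) zero_le_one
      _ = 2 * |G x| + κ * ∫ v, klFun (r (x, v)).toReal ∂γ := one_mul _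
  calc ∫ x, ∫ v, (r (x, v)).toReal * (φ x * g v) ∂γ ∂μ.fst
      ≤ ∫ x, (2 * |G x| + κ * ∫ v, klFun (r (x, v)).toReal ∂γ) ∂μ.fst :=
        integral_mono_ae hF_int.integral_prod_left
          ((hG_int.abs.const_mul 2).add (hkl_int.integral_prod_left.const_mul κ)) hinner
    _ = 2 * ∫ x, |G x| ∂μ.fst + κ * (klDiv μ (μ.fst.prod γ)).toReal := by
        rw [integral_add (hG_int.abs.const_mul 2) (hkl_int.integral_prod_left.const_mul κ),
          integral_const_mul, integral_const_mul, hK_eq]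
    _ ≤ 2 * (κ * Real.sqrt D.toReal) + κ * (klDiv μ (μ.fst.prod γ)).toReal := by
        gcongr
    _ = 2 * κ * Real.sqrt D.toReal + κ * (klDiv μ (μ.fst.prod γ)).toReal := by ring

/-- **Registered stub `stub_hellingerBiasSplit`** (line `kinetic-entropy-collision-budget`, crux stmt-AtomisticToContinuum-14135): for a probability law `π` on `𝕋³×ℝ³` with `KL(π‖πˣ⊗γ) < ∞`, measurable `|φ| ≤ 1`, `|g| ≤ κ`, `g ⊥ span(1,v,|v|²)` in `L²(γ)`: the fast deviation is finite and `∫ φ(x)g(v) dπ ≤ 2κ√fd(π) + κ·KL(π‖πˣ⊗γ)`. -/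
theorem stub_hellingerBiasSplit :
    ∀ (π : Measure (T3 × V3)), IsProbabilityMeasure π → klDiv π (π.fst.prod (stdGaussian V3)) ≠ ∞ →
      ∀ (φ : T3 → ℝ) (g : V3 → ℝ) (κ : ℝ), Measurable φ → Measurable g →
        (∀ x, |φ x| ≤ 1) → (∀ v, |g v| ≤ κ) →
        (∀ (c₀ c₂ : ℝ) (b : V3),
          ∫ v, g v * (c₀ + inner ℝ b v + c₂ * ‖v‖ ^ 2) ∂(stdGaussian V3) = 0) →
        ∀ D : ℝ≥0∞,
          D = ∫⁻ x, ⨅ q : ℝ × V3 × ℝ, ∫⁻ v, ENNReal.ofReal ((Real.sqrt ((π.rnDeriv (π.fst.prod (stdGaussian V3)) (x, v)).toReal) - 1 - (q.1 + inner ℝ q.2.1 v + q.2.2 * ‖v‖ ^ 2)) ^ 2) ∂(stdGaussian V3) ∂π.fst →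
          D ≠ ∞ ∧
            ∫ p, φ p.1 * g p.2 ∂π ≤ 2 * κ * Real.sqrt D.toReal + κ * (klDiv π (π.fst.prod (stdGaussian V3))).toReal := by
  intro π hπ hKL φ g κ hφm hgm hφ1 hgκ horth D hD
  have hg0 : ∫ v, g v ∂(stdGaussian V3) = 0 := by simpa using horth 1 0 0
  have h := integral_mul_le_of_orthogonal_of_klDiv π (stdGaussian V3) hKL
    (π.rnDeriv (π.fst.prod (stdGaussian V3))) rfl φ g κ hφm hgm hφ1 hgκ hg0
    (fun (q : ℝ × V3 × ℝ) v => q.1 + inner ℝ q.2.1 v + q.2.2 * ‖v‖ ^ 2)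
    (fun q => Continuous.measurable (by fun_prop)) ⟨(0, 0, 0), fun v => by simp⟩
    (fun q => horth q.1 q.2.2 q.2.1)
  subst hD
  exact ⟨ne_top_of_le_ne_top hKL h.1, h.2⟩

end Summit.AtomisticToContinuum.HydrodynamicLimit.Theorems.KineticEntropyCollisionBudget

end
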